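import Literature.Combinatorics.Optimization.ShellLawBulkSmoothness
import Literature.Combinatorics.Optimization.ShellLawReinsertionChain
import Literature.Combinatorics.Optimization.ShellLawSmoothing
import Mathlib.Data.Nat.Choose.Central
import HarnessLib

/-!
# Pointwise RELATIVE LEVEL-smoothness of the shell law of a block statistic in the moderate-deviation window:
# `Σ_{k=1}^{D} (C(2k,k)/4^k)·|Δ^k_j law(t,2j+1;x)|_{j=0}| ≤ law(t,1;x)` under explicit finite inequalities

The assembly of cell pnp-psdrank's [BULK] input (prover MEMO-26 §7) for the full ground set `univ` of a
fixed-point-free involution `π` on `Fin n` (a perfect matching with `N₀ = n/2` edges) and a block `H` of `H`-type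
`(a, b, d)`:

* Step 1 (`ShellLawSmoothing.sum_abs_nab2_iter_fwdDiff_iter_le`, singleton window `{x}`, `ρ = 1/3`): the `k`-th
  LEVEL difference of `c ↦ law_univ(t,c;x)` at `c = 1` (step `2`) is at most `3^{−k}` times the largest `2k`-th
  `x`-difference `|(∇²)^k law_{S'}(t−2k,·)(1)(x)|` over the `π`-stable `S' ⊆ univ` with `2k` edges deleted;
* Steps 2–4 (`ShellLawBulkSmoothness.abs_nab2_iter_shellLaw_one_le`): for each such `S'`,
  `|(∇²)^k law_{S'}(t−2k,·)(1)(x)| ≤ E_k·law_{S'}(t−2k,1;x−w₀) + 4^k e^{−(L−2k)²/(4N')}`, reference point `x − w₀`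
  INSIDE the stencil;
* Step 5 (`ShellLawReinsertionChain.shellLaw_reinsertion_le`, `k` edges re-inserted full, `k` empty, bases `β` and
  `1/4`): `law_{S'}(t−2k,1;x−w₀) ≤ (4/β)^k·law_univ(t,1;x)`;
* Step 6 (the window lower bound `LB ≤ law_univ(t,1;x)`) enters as a HYPOTHESIS (filed separately), against
  which the far terms `Σ_k (4/3)^k e^{−(L−2k)²/(4N')} ≤ D(4/3)^D e^{−(L−2D)²/(4N₀)}` are absorbed.

Contents: §1 helpers — `fwdDiff_iter_one_odd_profile` (step-`1` differences of `j ↦ law(t,2j+1;x)` are step-`2`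
differences of the profile), `card_eq_two_mul_add_of_types` (`|H| = 2a + b`), `window_transfer` (the reference point
of a deleted ground set stays within `Λ = ε + 14k + 1` of its own centre `s'(2a'+b')/N'`), `deleted_types`
(types and sizes of a `2k`-fold deleted ground set); §2 **`relSmooth_of_hyps`** — THE FINITE ASSEMBLY: under the
type margins `b, d ≥ βN₀ + 2D + 1`, the balanced cut size `βN₀ + D ≤ s`, `8s ≤ (4+β)(N₀ − 2D)`, the window
`|x − (2s+1)|H|/n| < ε`, and seven explicit numeric inequalities between `n, D, L, ε, β` and the lower bound `LB`,
the [BULK] inequality holds at `x`. The Summits-side consumer discharges the inequalities for `n ≥ n₀(β, K)`,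
`D⁴ ≤ n`, `ε = K√(|H|D)`, `L ≍ √(nD)`.

All PROVED, 0 sorry, no definitions, no named facts; constants crude and asymptotic only. Cell pnp-psdrank
(prover g24). Nothing here is about psd rank or P vs NP.

## References
* [RollinRoss2010] A. Röllin, N. Ross, *Local limit theorems via Landau–Kolmogorov inequalities*,
  Bernoulli 21 (2015) 851–880, §3 Lemma 3.1, 3.3; §4.1 Thm 4.2.
* [Rothvoss2017] T. Rothvoß, *The matching polytope has exponential extension complexity*, J. ACM 64
  (2017), §2 (PDF pp. 5–6).
* [Agarwal2000DifferenceEquations] R. P. Agarwal, *Difference Equations and Inequalities*, 2nd ed. (2000),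
  Thm. 1.8.5 (1.8.6), Remark 1.8.1 (Newton's forward-difference formula; `|C(−½,k)| = C(2k,k)/4^k`).
-/

noncomputable section

open Finset Polynomial

namespace Literature.Combinatorics.Optimization

namespace ShellStep

variable {n : ℕ} {π : Fin n → Fin n}

/-! ### §1 Helpers -/

/-- Step-`1` differences of the odd-level subsequence of a profile at a point are step-`2` differences of the
profile: `Δ^k_{(1)}[j ↦ P(2j+1)(x)](0) = (Δ^k_{(2)} P)(1)(x)`.
[cite: Agarwal2000DifferenceEquations, Thm. 1.8.5 (1.8.6)] -/
theorem fwdDiff_iter_one_odd_profile (P : Profile) (k : ℕ) (x : ℤ) :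
    (fwdDiff (1 : ℕ))^[k] (fun j : ℕ => P (2 * j + 1) x) 0 = ((fwdDiff (2 : ℕ))^[k] P) 1 x := by
  rw [fwdDiff_iter_eq_sum_shift, fwdDiff_iter_eq_sum_shift]
  simp only [Finset.sum_apply, Pi.smul_apply, smul_eq_mul, mul_one, zero_add]
  refine sum_congr rfl fun i _ => ?_
  congr 2
  ring

/-- `C(2k,k)/4^k ≤ 1`. [cite: Agarwal2000DifferenceEquations, Remark 1.8.1] -/
theorem centralBinom_div_four_pow_le_one' (k : ℕ) : (((2 * k).choose k : ℕ) : ℝ) / (4 : ℝ) ^ k ≤ 1 := by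
  rw [div_le_one (by positivity)]
  have h := Nat.centralBinom_le_four_pow k
  rw [Nat.centralBinom] at h
  exact_mod_cast h

section Types

variable (hπ : ∀ v, π (π v) = v) (hπ' : ∀ v, π v ≠ v)
include hπ hπ'

/-- **`|H| = 2a + b`**: a block meets the ground set `univ` of a perfect matching in twice the number of `HH` edges
plus the number of mixed edges. [cite: Rothvoss2017, §2 (PDF p. 5)] -/
theorem card_eq_two_mul_add_of_types (H : Finset (Fin n)) :
    H.card = 2 * (reps π (vAA π univ H)).card + (reps π (vBH π univ H ∪ vBN π univ H)).card := by
  have hst : ∀ v ∈ (univ : Finset (Fin n)), π v ∈ univ := fun v _ => mem_univ _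
  have hA := two_mul_card_reps hπ hπ' (vAA_stable hπ univ H hst)
  have hB := two_mul_card_reps hπ hπ' (vB_stable hπ univ H hst)
  have hBB := card_vBH_eq_card_vBN hπ hst H
  have hdisj : Disjoint (vBH π univ H) (vBN π univ H) :=
    disjoint_left.2 fun v hv hv' => (mem_vBN.1 hv').2.1 (mem_vBH.1 hv).2.1
  rw [card_union_of_disjoint hdisj] at hB
  have hH : H = vAA π univ H ∪ vBH π univ H := by
    ext v
    simp only [mem_union, mem_vAA, mem_vBH, mem_univ, true_and]
    tauto
  have hdisj2 : Disjoint (vAA π univ H) (vBH π univ H) :=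
    disjoint_left.2 fun v hv hv' => (mem_vBH.1 hv').2.2 (mem_vAA.1 hv).2.2
  have hcard : H.card = (vAA π univ H).card + (vBH π univ H).card := by
    conv_lhs => rw [hH]
    exact card_union_of_disjoint hdisj2
  omega

/-- **Types and sizes of a deleted ground set**: for `π`-stable `S' ⊆ univ` with `|S'| + 4k = n` and `univ` of
`H`-type `(a,b,d)` with `a+b+d = N₀`, the type `(a',b',d')` of `S'` satisfies `a − 2k ≤ a' ≤ a` (same for `b`, `d`)
and `a' + b' + d' + 2k = N₀`. [cite: Rothvoss2017, §2 (PDF p. 5)] -/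
theorem deleted_types (H : Finset (Fin n)) {a b d N₀ : ℕ} (ha : (reps π (vAA π univ H)).card = a)
    (hb : (reps π (vBH π univ H ∪ vBN π univ H)).card = b) (hd : (reps π (vDD π univ H)).card = d)
    (hN : a + b + d = N₀) {S' : Finset (Fin n)} (hS' : ∀ v ∈ S', π v ∈ S') {k : ℕ}
    (hcard : S'.card + 4 * k = n) :
    a ≤ (reps π (vAA π S' H)).card + 2 * k ∧ (reps π (vAA π S' H)).card ≤ a ∧
    b ≤ (reps π (vBH π S' H ∪ vBN π S' H)).card + 2 * k ∧ (reps π (vBH π S' H ∪ vBN π S' H)).card ≤ b ∧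
    d ≤ (reps π (vDD π S' H)).card + 2 * k ∧ (reps π (vDD π S' H)).card ≤ d ∧
    (reps π (vAA π S' H)).card + (reps π (vBH π S' H ∪ vBN π S' H)).card + (reps π (vDD π S' H)).card + 2 * k =
      N₀ := by
  have hst : ∀ v ∈ (univ : Finset (Fin n)), π v ∈ univ := fun v _ => mem_univ _
  obtain ⟨h1, h2, h3⟩ := two_mul_reps_le_of_subset hπ hπ' hst hS' H
  obtain ⟨h4, h5, h6⟩ := reps_card_le_of_subset (π := π) (subset_univ S') H
  have h7 := two_mul_typeReps_eq_card hπ hπ' hS' H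
  have h8 := two_mul_typeReps_eq_card hπ hπ' hst H
  rw [ha, hb, hd] at *
  have hsd : (univ \ S').card = 4 * k := by
    rw [card_sdiff, inter_eq_left.2 (subset_univ S'), card_univ, Fintype.card_fin]; omega
  rw [hsd] at h1 h2 h3
  rw [card_univ, Fintype.card_fin] at h8
  refine ⟨by omega, h4, by omega, h5, by omega, h6, by omega⟩

end Types

/-- **Window transfer** (pure real arithmetic): with `0 < N₀`, `0 ≤ P' ≤ P ≤ 2N₀`, `P ≤ P' + 6k`, `0 ≤ s ≤ 5N₀/8`,
`0 ≤ k`, `8k ≤ N₀`, `0 ≤ w₀ ≤ 2k` and `|x − (2s+1)P/(2N₀)| ≤ ε`: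
`|x − w₀ − (s−k)P'/(N₀−2k)| ≤ ε + 14k + 1`. [cite: Rothvoss2017, §2 (PDF p. 6)] -/
theorem window_transfer {P P' s N₀ k x w₀ ε : ℝ} (hN0 : 0 < N₀) (hP0 : 0 ≤ P') (hPP : P' ≤ P)
    (hP2 : P ≤ 2 * N₀) (hP6 : P ≤ P' + 6 * k) (hs0 : 0 ≤ s) (hs5 : 8 * s ≤ 5 * N₀) (hk0 : 0 ≤ k)
    (hk8 : 8 * k ≤ N₀) (hw0 : 0 ≤ w₀) (hw2 : w₀ ≤ 2 * k) (hx : |x - (2 * s + 1) * P / (2 * N₀)| ≤ ε) :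
    |x - w₀ - (s - k) * P' / (N₀ - 2 * k)| ≤ ε + 14 * k + 1 := by
  have hP : 0 ≤ P := hP0.trans hPP
  have hN'0 : 0 < N₀ - 2 * k := by linarith
  have hN'ne : N₀ - 2 * k ≠ 0 := hN'0.ne'
  have hN0ne : N₀ ≠ 0 := hN0.ne'
  -- the three pieces
  have h1 : |(2 * s + 1) * P / (2 * N₀) - s * P / N₀| ≤ 1 := by
    have e : (2 * s + 1) * P / (2 * N₀) - s * P / N₀ = P / (2 * N₀) := by field_simp; ring
    rw [e, abs_of_nonneg (div_nonneg hP (by linarith)), div_le_one (by linarith)]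
    linarith
  have t1 : |s * (P - P') / (N₀ - 2 * k)| ≤ 5 * k := by
    rw [abs_of_nonneg (div_nonneg (mul_nonneg hs0 (by linarith)) hN'0.le), div_le_iff₀ hN'0]
    have ha : s * (P - P') ≤ s * (6 * k) := mul_le_mul_of_nonneg_left (by linarith) hs0
    have hb : 0 ≤ k * (5 * (N₀ - 2 * k) - 6 * s) := mul_nonneg hk0 (by linarith)
    nlinarith
  have t2 : |2 * k * s * P / (N₀ * (N₀ - 2 * k))| ≤ 4 * k := by
    rw [abs_of_nonneg (div_nonneg (by positivity) (mul_pos hN0 hN'0).le), div_le_iff₀ (mul_pos hN0 hN'0)]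
    have ha : 2 * k * s * P ≤ 2 * k * s * (2 * N₀) := mul_le_mul_of_nonneg_left hP2 (by positivity)
    have hb : 0 ≤ k * N₀ * ((N₀ - 2 * k) - s) := mul_nonneg (mul_nonneg hk0 hN0.le) (by linarith)
    nlinarith
  have t3 : |k * P' / (N₀ - 2 * k)| ≤ 3 * k := by
    rw [abs_of_nonneg (div_nonneg (mul_nonneg hk0 hP0) hN'0.le), div_le_iff₀ hN'0]
    have ha : k * P' ≤ k * (2 * N₀) := mul_le_mul_of_nonneg_left (hPP.trans hP2) hk0
    have hb : 0 ≤ k * (3 * (N₀ - 2 * k) - 2 * N₀) := mul_nonneg hk0 (by linarith)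
    nlinarith
  have h2 : |s * P / N₀ - (s - k) * P' / (N₀ - 2 * k)| ≤ 12 * k := by
    have e : s * P / N₀ - (s - k) * P' / (N₀ - 2 * k) =
        s * (P - P') / (N₀ - 2 * k) - 2 * k * s * P / (N₀ * (N₀ - 2 * k)) + k * P' / (N₀ - 2 * k) := by
      obtain ⟨M, hM⟩ : ∃ M : ℝ, M = N₀ - 2 * k := ⟨_, rfl⟩
      have hMne : M ≠ 0 := by rw [hM]; exact hN'ne
      rw [← hM]
      field_simp
      rw [hM]
      ring
    rw [e]
    have := abs_add_le (s * (P - P') / (N₀ - 2 * k) - 2 * k * s * P / (N₀ * (N₀ - 2 * k))) (k * P' / (N₀ - 2 * k))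
    have := abs_sub (s * (P - P') / (N₀ - 2 * k)) (2 * k * s * P / (N₀ * (N₀ - 2 * k)))
    linarith
  -- triangle inequality
  have e : x - w₀ - (s - k) * P' / (N₀ - 2 * k) =
      (x - (2 * s + 1) * P / (2 * N₀)) + ((2 * s + 1) * P / (2 * N₀) - s * P / N₀) +
        (s * P / N₀ - (s - k) * P' / (N₀ - 2 * k)) - w₀ := by ring
  rw [e]
  have hw : |w₀| ≤ 2 * k := by rw [abs_of_nonneg hw0]; exact hw2
  have i1 := abs_sub ((x - (2 * s + 1) * P / (2 * N₀)) + ((2 * s + 1) * P / (2 * N₀) - s * P / N₀) +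
    (s * P / N₀ - (s - k) * P' / (N₀ - 2 * k))) w₀
  have i2 := abs_add_le ((x - (2 * s + 1) * P / (2 * N₀)) + ((2 * s + 1) * P / (2 * N₀) - s * P / N₀))
    (s * P / N₀ - (s - k) * P' / (N₀ - 2 * k))
  have i3 := abs_add_le (x - (2 * s + 1) * P / (2 * N₀)) ((2 * s + 1) * P / (2 * N₀) - s * P / N₀)
  linarith

/-! ### §2 The finite assembly -/

/-- A sum over `k = 1, …, D` of terms bounded by `M` is at most `D·M`.
[cite: RollinRoss2010, §3 (Lemma 3.1)] -/
private theorem sum_Ico_le_mul {f : ℕ → ℝ} {D : ℕ} {M : ℝ} (h : ∀ k ∈ Ico 1 (D + 1), f k ≤ M) :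
    ∑ k ∈ Ico 1 (D + 1), f k ≤ D * M := by
  calc ∑ k ∈ Ico 1 (D + 1), f k ≤ ∑ k ∈ Ico 1 (D + 1), M := sum_le_sum h
    _ = D * M := by rw [sum_const, Nat.card_Ico, nsmul_eq_mul]; push_cast; ring_nf

section Assembly

variable (hπ : ∀ v, π (π v) = v) (hπ' : ∀ v, π v ≠ v)
include hπ hπ'

/-- **RELATIVE LEVEL-SMOOTHNESS OF THE SHELL LAW IN THE WINDOW (finite form).** `π` a fixed-point-free involution
on `Fin n`, `n = 2N₀`, a block `H` of `H`-type `(a,b,d)` (`a+b+d = N₀`), `0 < β ≤ 1/4`, an order bound `D` with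
`16D + 16 ≤ N₀`, type margins `b, d ≥ βN₀ + 2D + 1` (mixed and `H̄H̄` edges; no condition on `a`), a balanced number
of full edges `βN₀ + D ≤ s`,
`8s ≤ (4+β)(N₀−2D)` (cut size `t = 2s+1` with nonempty shells `Shell(t, 2k+1)`, `k ≤ D`), a point `x ≥ 2D` in the
window `|x − t|H|/n| < ε`, a window half-width `L ∈ [2D, N₀/2]`, a lower bound `LB ≤ law(t,1;x)`, and the numeric
inequalities (`Λ = ε + 14D + 1`, `β₁ = β²/8`, `N₁ = N₀ − 2D`, `η* = 8(L+D+1)/(β₁⁴βN₁)`,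
`Q* = 2√192·√(2(2D+1)(1+η*)/(β₁⁴βN₁))`, `ρ* = (1+η*)(η*+Q*)`, `Γ = 1 + (4(√N₀+1)/3)Q*`):
`L + D + Λ ≤ β²N₀`, `L + D + Λ + 3 ≤ βN₁/8`, `2(L+D+1) ≤ β₁²βN₁`, `4 ≤ βN₁`, `D(1+η*) ≤ β₁⁴βN₁`, `16Γρ*² ≤ 3β`,
`D(4/3)^D e^{−(L−2D)²/(4N₀)} ≤ LB/2`. THEN
`Σ_{k=1}^{D} (C(2k,k)/4^k)·|Δ^k[j ↦ law(t,2j+1;x)](0)| ≤ law(t,1;x)`.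
[cite: RollinRoss2010, §3 (Lemma 3.1, 3.3), §4.1 Thm 4.2] [cite: Rothvoss2017, §2 (PDF p. 6)]
[cite: Agarwal2000DifferenceEquations, Thm. 1.8.5 (1.8.6), Remark 1.8.1] -/
theorem relSmooth_of_hyps (H : Finset (Fin n)) {a b d N₀ : ℕ} (ha : (reps π (vAA π univ H)).card = a)
    (hb : (reps π (vBH π univ H ∪ vBN π univ H)).card = b) (hd : (reps π (vDD π univ H)).card = d)
    (hN : a + b + d = N₀) (hn : n = 2 * N₀)
    {β : ℝ} (hβ : 0 < β) (hβ1 : β ≤ 1 / 4) {D : ℕ} (hDN : 16 * D + 16 ≤ N₀)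
    (hbβ : β * N₀ + 2 * D + 1 ≤ b) (hdβ : β * N₀ + 2 * D + 1 ≤ d)
    {s : ℕ} (hs : β * N₀ + D ≤ s) (hs' : 8 * (s : ℝ) ≤ (4 + β) * ((N₀ : ℝ) - 2 * D))
    (hne : ∀ k, k ≤ D → (shellIn π univ (2 * s + 1) (1 + 2 * k)).Nonempty)
    {x : ℕ} {ε : ℝ} (hxε : |(x : ℝ) - (2 * (s : ℝ) + 1) * H.card / n| < ε) (hxD : 2 * D ≤ x)
    {L : ℝ} (h2D : 2 * (D : ℝ) ≤ L) (hLN : 2 * L ≤ N₀)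
    (h1 : L + D + (ε + 14 * D + 1) ≤ β ^ 2 * N₀)
    (h2 : L + D + (ε + 14 * D + 1) + 3 ≤ β * ((N₀ : ℝ) - 2 * D) / 8)
    (h3 : 2 * (L + D + 1) ≤ (β ^ 2 / 8) ^ 2 * (β * ((N₀ : ℝ) - 2 * D)))
    (h4 : 4 ≤ β * ((N₀ : ℝ) - 2 * D))
    (h5 : (D : ℝ) * (1 + 8 * (L + D + 1) / ((β ^ 2 / 8) ^ 4 * (β * ((N₀ : ℝ) - 2 * D)))) ≤
      (β ^ 2 / 8) ^ 4 * (β * ((N₀ : ℝ) - 2 * D)))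
    (h7 : 16 * (1 + 4 * (Real.sqrt N₀ + 1) / 3 *
        (2 * Real.sqrt 192 * Real.sqrt (2 * (2 * (D : ℝ) + 1) *
          (1 + 8 * (L + D + 1) / ((β ^ 2 / 8) ^ 4 * (β * ((N₀ : ℝ) - 2 * D)))) /
            ((β ^ 2 / 8) ^ 4 * (β * ((N₀ : ℝ) - 2 * D)))))) *
      ((1 + 8 * (L + D + 1) / ((β ^ 2 / 8) ^ 4 * (β * ((N₀ : ℝ) - 2 * D)))) *
        (8 * (L + D + 1) / ((β ^ 2 / 8) ^ 4 * (β * ((N₀ : ℝ) - 2 * D))) +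
          2 * Real.sqrt 192 * Real.sqrt (2 * (2 * (D : ℝ) + 1) *
            (1 + 8 * (L + D + 1) / ((β ^ 2 / 8) ^ 4 * (β * ((N₀ : ℝ) - 2 * D)))) /
              ((β ^ 2 / 8) ^ 4 * (β * ((N₀ : ℝ) - 2 * D)))))) ^ 2 ≤ 3 * β)
    {LB : ℝ} (hLB : LB ≤ shellLaw π univ H (2 * s + 1) 1 x)
    (h8 : (D : ℝ) * (4 / 3 : ℝ) ^ D * Real.exp (-((L - 2 * D) ^ 2 / (4 * N₀))) ≤ LB / 2) :
    ∑ k ∈ Ico 1 (D + 1), (((2 * k).choose k : ℕ) : ℝ) / (4 : ℝ) ^ k *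
        |(fwdDiff (1 : ℕ))^[k] (fun j => shellLaw π univ H (2 * s + 1) (2 * j + 1) x) 0| ≤
      shellLaw π univ H (2 * s + 1) 1 x := by
  classical
  -- abbreviations (opaque)
  obtain ⟨N₁, hN₁⟩ : ∃ e : ℝ, e = (N₀ : ℝ) - 2 * D := ⟨_, rfl⟩
  obtain ⟨ηs, hηs⟩ : ∃ e : ℝ, e = 8 * (L + D + 1) / ((β ^ 2 / 8) ^ 4 * (β * N₁)) := ⟨_, rfl⟩
  obtain ⟨Qs, hQs⟩ : ∃ e : ℝ, e = 2 * Real.sqrt 192 * Real.sqrt (2 * (2 * (D : ℝ) + 1) * (1 + ηs) /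
    ((β ^ 2 / 8) ^ 4 * (β * N₁))) := ⟨_, rfl⟩
  obtain ⟨Γ, hΓ⟩ : ∃ e : ℝ, e = 1 + 4 * (Real.sqrt N₀ + 1) / 3 * Qs := ⟨_, rfl⟩
  obtain ⟨ρs, hρs⟩ : ∃ e : ℝ, e = (1 + ηs) * (ηs + Qs) := ⟨_, rfl⟩
  rw [← hN₁] at hs' h2 h3 h4 h5 h7
  rw [← hηs] at h5 h7
  rw [← hQs, ← hΓ, ← hρs] at h7
  obtain ⟨law, hlaw⟩ : ∃ e : ℝ, e = shellLaw π univ H (2 * s + 1) 1 x := ⟨_, rfl⟩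
  rw [← hlaw] at hLB ⊢
  obtain ⟨Λ, hΛ⟩ : ∃ e : ℝ, e = ε + 14 * D + 1 := ⟨_, rfl⟩
  rw [← hΛ] at h1 h2
  -- basic positivity / sizes
  have hst : ∀ v ∈ (univ : Finset (Fin n)), π v ∈ univ := fun v _ => mem_univ _
  have hD0 : (0 : ℝ) ≤ D := Nat.cast_nonneg _
  have hDN' : (16 : ℝ) * D + 16 ≤ N₀ := by exact_mod_cast hDN
  have hN₀pos : (0 : ℝ) < N₀ := by linarith only [hDN', hD0]
  have hN₁pos : 0 < N₁ := by rw [hN₁]; linarith only [hDN', hD0]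
  have hN₁N₀ : N₁ ≤ N₀ := by rw [hN₁]; linarith only [hD0]
  have hβ1' : β ≤ 1 := by linarith only [hβ1]
  have hε0 : 0 ≤ ε := le_of_lt (lt_of_le_of_lt (abs_nonneg _) hxε)
  have hL0 : 0 ≤ L := le_trans (by positivity) h2D
  have hΛ0 : 0 ≤ Λ := by rw [hΛ]; positivity
  have hηs0 : 0 ≤ ηs := by rw [hηs]; positivity
  have hQs0 : 0 ≤ Qs := by rw [hQs]; positivity
  have hΓ1 : 1 ≤ Γ := by
    rw [hΓ]; linarith only [show (0 : ℝ) ≤ 4 * (Real.sqrt N₀ + 1) / 3 * Qs by positivity]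
  have hΓ0 : 0 ≤ Γ := zero_le_one.trans hΓ1
  have hρs0 : 0 ≤ ρs := by rw [hρs]; positivity
  have hlaw0 : 0 ≤ law := by rw [hlaw]; exact shellLaw_nonneg (π := π) _ _ _ _ _
  have hβN₀ : 0 ≤ β * N₀ := by positivity
  have hsD : D ≤ s := by
    have : (D : ℝ) ≤ s := by linarith only [hs, hβN₀]
    exact_mod_cast this
  -- `|H| = 2a + b`
  have hHcard : (H.card : ℝ) = 2 * a + b := by
    have := card_eq_two_mul_add_of_types hπ hπ' H
    rw [ha, hb] at this
    exact_mod_cast this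
  -- the window hypothesis in centre form
  have hxwin : |(x : ℝ) - (2 * (s : ℝ) + 1) * (2 * a + b) / (2 * N₀)| ≤ ε := by
    have e : (2 * (s : ℝ) + 1) * H.card / n = (2 * (s : ℝ) + 1) * (2 * a + b) / (2 * N₀) := by
      rw [hHcard, show (n : ℝ) = 2 * N₀ by exact_mod_cast hn]
    rw [← e]; exact hxε.le
  -- the ratio `q = 4ρ*²/(3β) ≤ 1/4` and the main-term budget `Γ·q/(1−q) ≤ 1/2`
  have hq : 16 * ρs ^ 2 ≤ 3 * β := by
    have : ρs ^ 2 ≤ Γ * ρs ^ 2 := le_mul_of_one_le_left (sq_nonneg _) hΓ1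
    linarith only [this, h7]
  obtain ⟨q, hqdef⟩ : ∃ e : ℝ, e = 4 * ρs ^ 2 / (3 * β) := ⟨_, rfl⟩
  have hq0 : 0 ≤ q := by rw [hqdef]; positivity
  have hq4 : q ≤ 1 / 4 := by
    rw [hqdef, div_le_iff₀ (by positivity)]; linarith only [hq]
  have hΓq : Γ * (q / (1 - q)) ≤ 1 / 2 := by
    have h1q : 3 / 4 ≤ 1 - q := by linarith only [hq4]
    have hq' : q / (1 - q) ≤ q / (3 / 4) := div_le_div_of_nonneg_left hq0 (by norm_num) h1q
    have hΓq' : Γ * q ≤ 3 / 8 := by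
      rw [hqdef]
      have : Γ * (4 * ρs ^ 2 / (3 * β)) = (16 * Γ * ρs ^ 2) / (12 * β) := by
        field_simp; ring
      rw [this, div_le_iff₀ (by positivity)]
      linarith only [h7, hβ.le]
    calc Γ * (q / (1 - q)) ≤ Γ * (q / (3 / 4)) := mul_le_mul_of_nonneg_left hq' hΓ0
      _ = 4 / 3 * (Γ * q) := by ring
      _ ≤ 4 / 3 * (3 / 8) := by linarith only [hΓq']
      _ = 1 / 2 := by norm_num
  -- uniform constants
  have hc0 : 0 < (β ^ 2 / 8) ^ 4 * (β * N₁) := by positivity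
  -- THE PER-`k` BOUND
  have hper : ∀ k ∈ Ico 1 (D + 1), (((2 * k).choose k : ℕ) : ℝ) / (4 : ℝ) ^ k *
      |(fwdDiff (1 : ℕ))^[k] (fun j => shellLaw π univ H (2 * s + 1) (2 * j + 1) x) 0| ≤
      Γ * q ^ k * law + (4 / 3 : ℝ) ^ k * Real.exp (-((L - 2 * D) ^ 2 / (4 * N₀))) := by
    intro k hk
    obtain ⟨hk1, hkD⟩ := mem_Ico.1 hk
    have hkD' : k ≤ D := by omega
    have hkDr : (k : ℝ) ≤ D := by exact_mod_cast hkD'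
    have hk0r : (0 : ℝ) ≤ k := Nat.cast_nonneg _
    have hks : k ≤ s := hkD'.trans hsD
    have hskr : ((s - k : ℕ) : ℝ) = (s : ℝ) - k := by push_cast [Nat.cast_sub hks]; ring
    -- the uniform per-`S'` bound `B`
    obtain ⟨B, hBdef⟩ : ∃ e : ℝ, e = Γ * ρs ^ (2 * k) * ((4 : ℝ) / β) ^ k * law +
      (4 : ℝ) ^ k * Real.exp (-((L - 2 * D) ^ 2 / (4 * N₀))) := ⟨_, rfl⟩
    have hB0 : 0 ≤ B := by rw [hBdef]; positivity
    -- Step 1: the singleton-window level smoothing with `ρ = 1/3`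
    have ht : 2 * (s - k) + 1 + 2 * k = 2 * s + 1 := by omega
    have hne' : (shellIn π univ (2 * (s - k) + 1 + 2 * k) (1 + 2 * k)).Nonempty := by
      rw [ht]; exact hne k hkD'
    have hstep := sum_abs_nab2_iter_fwdDiff_iter_le hπ hπ' H (2 * (s - k) + 1) {(x : ℤ)}
      (ρ := 1 / 3) (B := B) (by norm_num) hB0 k 0 hst 1 hne'
      (fun S' _ hS' hlt => by
        have h8 : 8 ≤ S'.card := by rw [card_univ, Fintype.card_fin] at hlt; omega
        have h := pairs_le_rho hπ hS' H (m := 8) (by norm_num) h8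
        have e : ((8 : ℕ) : ℝ) / (4 * (((8 : ℕ) : ℝ) - 2)) = 1 / 3 := by norm_num
        rw [e] at h; exact h)
      ?_
    · -- conclude the per-`k` bound from Step 1
      simp only [sum_singleton, Function.iterate_zero, id_eq, ht] at hstep
      rw [fwdDiff_iter_one_odd_profile (fun c' x' => shellLaw π univ H (2 * s + 1) c' x' : Profile) k (x : ℤ)]
      have hcb := centralBinom_div_four_pow_le_one' k
      calc (((2 * k).choose k : ℕ) : ℝ) / (4 : ℝ) ^ k *
            |((fwdDiff (2 : ℕ))^[k] (fun c' x' => shellLaw π univ H (2 * s + 1) c' x' : Profile)) 1 (x : ℤ)|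
          ≤ 1 * ((1 / 3 : ℝ) ^ k * B) := mul_le_mul hcb hstep (abs_nonneg _) zero_le_one
        _ = Γ * q ^ k * law + (4 / 3 : ℝ) ^ k * Real.exp (-((L - 2 * D) ^ 2 / (4 * N₀))) := by
            have hβ0 : β ≠ 0 := hβ.ne'
            have e1 : (4 * ρs ^ 2 / (3 * β)) ^ k = (1 / 3 : ℝ) ^ k * (ρs ^ (2 * k) * ((4 : ℝ) / β) ^ k) := by
              rw [show (4 : ℝ) * ρs ^ 2 / (3 * β) = 1 / 3 * (ρs ^ 2 * (4 / β)) by field_simp]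
              rw [mul_pow, mul_pow, ← pow_mul]
            have e2 : (4 / 3 : ℝ) ^ k = (1 / 3 : ℝ) ^ k * 4 ^ k := by rw [← mul_pow]; norm_num
            rw [hBdef, hqdef, one_mul, e1, e2]; ring
    -- hypothesis (ii) of Step 1: the bound `B` on every `2k`-fold deleted ground set
    intro S' _ hS' hcardS'
    rw [zero_add, sum_singleton]
    rw [card_univ, Fintype.card_fin] at hcardS'
    -- types of `S'`
    obtain ⟨ha1, ha2, hb1, hb2, hd1, hd2, hN'⟩ := deleted_types hπ hπ' H ha hb hd hN hS' hcardS'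
    generalize ha' : (reps π (vAA π S' H)).card = a' at ha1 ha2 hN'
    generalize hb' : (reps π (vBH π S' H ∪ vBN π S' H)).card = b' at hb1 hb2 hN'
    generalize hd' : (reps π (vDD π S' H)).card = d' at hd1 hd2 hN'
    obtain ⟨N', hN'def⟩ : ∃ N' : ℕ, N' + 2 * k = N₀ := ⟨a' + b' + d', hN'⟩
    have hN'sum : a' + b' + d' = N' := by omega
    have hN'r : (N' : ℝ) = (N₀ : ℝ) - 2 * k := by
      have : ((N' + 2 * k : ℕ) : ℝ) = N₀ := by rw [hN'def]
      push_cast at this; linarith only [this]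
    have hN₁N' : N₁ ≤ N' := by rw [hN₁, hN'r]; linarith only [hkDr]
    have hN'N₀ : (N' : ℝ) ≤ N₀ := by rw [hN'r]; linarith only [hk0r]
    have hN'pos : (0 : ℝ) < N' := lt_of_lt_of_le hN₁pos hN₁N'
    have ha1r : (a : ℝ) ≤ a' + 2 * k := by exact_mod_cast ha1
    have ha2r : (a' : ℝ) ≤ a := by exact_mod_cast ha2
    have hb1r : (b : ℝ) ≤ b' + 2 * k := by exact_mod_cast hb1
    have hb2r : (b' : ℝ) ≤ b := by exact_mod_cast hb2
    have hd1r : (d : ℝ) ≤ d' + 2 * k := by exact_mod_cast hd1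
    have hNr : (a : ℝ) + b + d = N₀ := by exact_mod_cast hN
    have hβN' : β * N₁ ≤ β * N' := mul_le_mul_of_nonneg_left hN₁N' hβ.le
    have hβN'' : β * N' ≤ β * N₀ := mul_le_mul_of_nonneg_left hN'N₀ hβ.le
    have hc1 : (β ^ 2 / 8) ^ 4 * (β * N₁) ≤ (β ^ 2 / 8) ^ 4 * (β * N') :=
      mul_le_mul_of_nonneg_left hβN' (by positivity)
    -- Step 5: re-insertion (`k` full with base `β`, `k` empty with base `1/4`)
    have hcard2 : S'.card + 2 * (2 * k) = (univ : Finset (Fin n)).card := by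
      rw [card_univ, Fintype.card_fin]; omega
    have hnr : (n : ℝ) = 2 * N₀ := by exact_mod_cast hn
    have hS'r : (S'.card : ℝ) = 2 * N₀ - 4 * k := by
      have : ((S'.card + 4 * k : ℕ) : ℝ) = (n : ℝ) := by rw [hcardS']
      push_cast at this; linarith only [this, hnr]
    have hF : β * ((univ : Finset (Fin n)).card : ℝ) ≤ ((2 * (s - k) + 1 : ℕ) : ℝ) + 2 - (1 : ℕ) := by
      rw [card_univ, Fintype.card_fin, hnr]; push_cast; rw [hskr]
      linarith only [hs, hkDr, hβN₀]
    have hE : (1 / 4 : ℝ) * ((univ : Finset (Fin n)).card : ℝ) ≤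
        (S'.card : ℝ) + 2 - ((2 * (s - k) + 1 : ℕ) : ℝ) - 2 * (k : ℕ) - (1 : ℕ) := by
      rw [card_univ, Fintype.card_fin, hnr, hS'r]; push_cast; rw [hskr]
      have h45 : (4 + β) * N₁ ≤ 5 * N₁ := mul_le_mul_of_nonneg_right (by linarith only [hβ1']) hN₁pos.le
      rw [hN₁] at h45
      have : (4 + β) * N₁ = (4 + β) * ((N₀ : ℝ) - 2 * D) := by rw [hN₁]
      rw [this] at hs'
      linarith only [hs', h45, hDN', hkDr, hk0r]
    obtain ⟨w₀, hw₀, hreins⟩ := shellLaw_reinsertion_le hπ hπ' H 1 hβ.le (by norm_num : (0:ℝ) ≤ 1 / 4)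
      (2 * k) hst hS' (subset_univ _) hcard2 (2 * (s - k) + 1) k (by omega) hF hE
    have hreinsx := hreins (x : ℤ)
    rw [show 2 * k - k = k by omega, ht] at hreinsx
    -- the reference point `y₀ = x − w₀`
    have hw₀x : w₀ ≤ x := by omega
    obtain ⟨y₀, hy₀⟩ : ∃ y₀ : ℕ, y₀ + w₀ = x := ⟨x - w₀, by omega⟩
    have hy₀z : ((x : ℤ) - (w₀ : ℤ)) = (y₀ : ℤ) := by rw [← hy₀]; push_cast; ring
    rw [hy₀z, ← hlaw] at hreinsx
    have hw₀r : (w₀ : ℝ) ≤ 2 * k := by exact_mod_cast hw₀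
    -- the window transfer
    have hy₀win : |(y₀ : ℝ) - ((s - k : ℕ) : ℝ) * (2 * a' + b') / N'| ≤ Λ := by
      have hw := window_transfer (P := (2 * a + b : ℝ)) (P' := (2 * a' + b' : ℝ)) (s := s) (N₀ := N₀)
        (k := k) (x := x) (w₀ := w₀) (ε := ε) hN₀pos (by positivity) (by linarith only [ha2r, hb2r])
        (by linarith only [hNr, Nat.cast_nonneg (α := ℝ) d]) (by linarith only [ha1r, hb1r])
        (Nat.cast_nonneg _)
        (by have h45 : (4 + β) * N₁ ≤ 5 * N₀ := by
              calc (4 + β) * N₁ ≤ 5 * N₁ := mul_le_mul_of_nonneg_right (by linarith only [hβ1']) hN₁pos.le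
                _ ≤ 5 * N₀ := by linarith only [hN₁N₀]
            linarith only [hs', h45])
        hk0r (by linarith only [hDN', hkDr]) (Nat.cast_nonneg _) hw₀r hxwin
      have e1 : (y₀ : ℝ) = x - w₀ := by
        have : ((y₀ + w₀ : ℕ) : ℝ) = x := by rw [hy₀]
        push_cast at this; linarith only [this]
      have e2 : ((s - k : ℕ) : ℝ) * (2 * a' + b') / N' = ((s : ℝ) - k) * (2 * a' + b') / ((N₀ : ℝ) - 2 * k) := by
        rw [hN'r, hskr]
      rw [e1, e2]
      refine hw.trans ?_
      rw [hΛ]; linarith only [hkDr]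
    -- Steps 2–4 on `S'`
    have hβs : β * N' ≤ ((s - k : ℕ) : ℝ) := by rw [hskr]; linarith only [hs, hkDr, hβN'']
    have h8s : 8 * ((s - k : ℕ) : ℝ) ≤ (4 + β) * N' := by
      rw [hskr]
      have : (4 + β) * N₁ ≤ (4 + β) * N' := mul_le_mul_of_nonneg_left hN₁N' (by linarith only [hβ.le])
      linarith only [hs', this, hk0r]
    have hsN' : s - k ≤ N' := by
      have : ((s - k : ℕ) : ℝ) ≤ N' := by
        have : (4 + β) * N' ≤ 5 * N' := mul_le_mul_of_nonneg_right (by linarith only [hβ1']) hN'pos.le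
        linarith only [h8s, this]
      exact_mod_cast this
    have hη' : 8 * (L + k + 1) / ((β ^ 2 / 8) ^ 4 * (β * N')) ≤ ηs := by
      rw [hηs]
      calc 8 * (L + k + 1) / ((β ^ 2 / 8) ^ 4 * (β * N')) ≤ 8 * (L + D + 1) / ((β ^ 2 / 8) ^ 4 * (β * N')) :=
            div_le_div_of_nonneg_right (by linarith only [hkDr]) (hc0.le.trans hc1)
        _ ≤ 8 * (L + D + 1) / ((β ^ 2 / 8) ^ 4 * (β * N₁)) :=
            div_le_div_of_nonneg_left (by linarith only [hL0, hD0]) hc0 hc1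
    have hone := abs_nab2_iter_shellLaw_one_le hπ hπ' hS' H (a := a') hb' hd' hN'sum hβ hβ1'
      (by linarith only [hb1r, hbβ, hkDr, hβN''])
      (by linarith only [hd1r, hdβ, hkDr, hβN''])
      (s := s - k) hβs h8s hsN'
      (k := k) (u := w₀) (y₀ := y₀) hw₀ (L := L) (Λ := Λ)
      (by linarith only [h2D, hkDr]) (by linarith only [hLN, hN'r, hDN', hkDr, hk0r])
      (by -- `L + k + Λ ≤ β(s−k)`
          have hmul : β * (β * N₀) ≤ β * ((s - k : ℕ) : ℝ) :=
            mul_le_mul_of_nonneg_left (by rw [hskr]; linarith only [hs, hkDr]) hβ.le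
          have e : β ^ 2 * (N₀ : ℝ) = β * (β * N₀) := by ring
          linarith only [h1, hmul, hkDr, e])
      (by linarith only [h2, hβN', hkDr])
      (by have : (β ^ 2 / 8) ^ 2 * (β * N₁) ≤ (β ^ 2 / 8) ^ 2 * (β * N') :=
            mul_le_mul_of_nonneg_left hβN' (by positivity)
          linarith only [h3, this, hkDr])
      (by linarith only [h4, hβN'])
      (by calc (k : ℝ) * (1 + 8 * (L + k + 1) / ((β ^ 2 / 8) ^ 4 * (β * N'))) ≤ (D : ℝ) * (1 + ηs) :=
                mul_le_mul hkDr (by linarith only [hη']) (by positivity) hD0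
            _ ≤ (β ^ 2 / 8) ^ 4 * (β * N₁) := h5
            _ ≤ _ := hc1)
      hy₀win
    rw [hy₀] at hone
    -- bound the constants of `hone` by the uniform ones
    have hη0 : 0 ≤ 8 * (L + k + 1) / ((β ^ 2 / 8) ^ 4 * (β * N')) := by positivity
    have hQle : 2 * Real.sqrt 192 * Real.sqrt (2 * (2 * (k : ℝ) + 1) *
        (1 + 8 * (L + k + 1) / ((β ^ 2 / 8) ^ 4 * (β * N'))) / ((β ^ 2 / 8) ^ 4 * (β * N'))) ≤ Qs := by
      rw [hQs]
      refine mul_le_mul_of_nonneg_left (Real.sqrt_le_sqrt ?_) (by positivity)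
      have hnum : 2 * (2 * (k : ℝ) + 1) * (1 + 8 * (L + k + 1) / ((β ^ 2 / 8) ^ 4 * (β * N'))) ≤
          2 * (2 * (D : ℝ) + 1) * (1 + ηs) :=
        mul_le_mul (by linarith only [hkDr]) (by linarith only [hη']) (by positivity) (by positivity)
      calc _ ≤ 2 * (2 * (D : ℝ) + 1) * (1 + ηs) / ((β ^ 2 / 8) ^ 4 * (β * N')) :=
            div_le_div_of_nonneg_right hnum (hc0.le.trans hc1)
        _ ≤ 2 * (2 * (D : ℝ) + 1) * (1 + ηs) / ((β ^ 2 / 8) ^ 4 * (β * N₁)) :=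
            div_le_div_of_nonneg_left (by positivity) hc0 hc1
    have hsqrt : 4 * (Real.sqrt N' + 1) / 3 ≤ 4 * (Real.sqrt N₀ + 1) / 3 := by
      have := Real.sqrt_le_sqrt hN'N₀; linarith only [this]
    have hmono := goodConst_mono (2 * k) hη0 hη' (by positivity) hQle (by positivity) hsqrt
    rw [← hρs] at hmono
    have hmono' : ((1 + 8 * (L + k + 1) / ((β ^ 2 / 8) ^ 4 * (β * N'))) *
        (8 * (L + k + 1) / ((β ^ 2 / 8) ^ 4 * (β * N')) +
          2 * Real.sqrt 192 * Real.sqrt (2 * (2 * (k : ℝ) + 1) *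
            (1 + 8 * (L + k + 1) / ((β ^ 2 / 8) ^ 4 * (β * N'))) / ((β ^ 2 / 8) ^ 4 * (β * N'))))) ^ (2 * k) *
        (1 + 4 * (Real.sqrt N' + 1) / 3 *
          (2 * Real.sqrt 192 * Real.sqrt (2 * (2 * (k : ℝ) + 1) *
            (1 + 8 * (L + k + 1) / ((β ^ 2 / 8) ^ 4 * (β * N'))) / ((β ^ 2 / 8) ^ 4 * (β * N'))))) ≤
        Γ * ρs ^ (2 * k) := by
      rw [hΓ, mul_comm (1 + 4 * (Real.sqrt ↑N₀ + 1) / 3 * Qs)]; exact hmono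
    -- the comparability factor
    have hlawS : shellLaw π S' H (2 * (s - k) + 1) 1 y₀ ≤ ((4 : ℝ) / β) ^ k * law := by
      have hpos : 0 < β ^ k * (1 / 4 : ℝ) ^ k := by positivity
      have hprod : β ^ k * (1 / 4 : ℝ) ^ k * ((4 : ℝ) / β) ^ k = 1 := by
        rw [← mul_pow, ← mul_pow]
        have : β * (1 / 4 : ℝ) * (4 / β) = 1 := by field_simp
        rw [this, one_pow]
      have e : ((4 : ℝ) / β) ^ k * law = law / (β ^ k * (1 / 4 : ℝ) ^ k) := by
        rw [eq_div_iff hpos.ne']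
        calc (4 / β) ^ k * law * (β ^ k * (1 / 4 : ℝ) ^ k)
            = law * (β ^ k * (1 / 4 : ℝ) ^ k * ((4 : ℝ) / β) ^ k) := by ring
          _ = law := by rw [hprod, mul_one]
      rw [e, le_div_iff₀ hpos, mul_comm]
      exact hreinsx
    have e1 : 1 + 2 * (s - k) = 2 * (s - k) + 1 := by ring
    -- the far term
    have hfar : (4 : ℝ) ^ k * Real.exp (-((L - 2 * k) ^ 2 / (4 * N'))) ≤
        (4 : ℝ) ^ k * Real.exp (-((L - 2 * D) ^ 2 / (4 * N₀))) := by
      refine mul_le_mul_of_nonneg_left (Real.exp_le_exp.2 ?_) (by positivity)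
      have h0 : 0 ≤ L - 2 * D := by linarith only [h2D]
      have h1 : (L - 2 * D) ^ 2 ≤ (L - 2 * k) ^ 2 :=
        pow_le_pow_left₀ h0 (by linarith only [hkDr]) 2
      have h2 : (L - 2 * D) ^ 2 / (4 * N₀) ≤ (L - 2 * k) ^ 2 / (4 * N') := by
        calc (L - 2 * D) ^ 2 / (4 * N₀) ≤ (L - 2 * D) ^ 2 / (4 * N') :=
              div_le_div_of_nonneg_left (sq_nonneg _) (by positivity) (by linarith only [hN'N₀])
          _ ≤ (L - 2 * k) ^ 2 / (4 * N') := div_le_div_of_nonneg_right h1 (by positivity)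
      linarith only [h2]
    -- assemble `B`
    rw [e1] at hone
    calc |nab2^[k] (fun c' x => shellLaw π S' H (2 * (s - k) + 1) c' x : Profile) 1 (x : ℤ)|
        = |nab2^[k] (fun c' x => shellLaw π S' H (2 * (s - k) + 1) c' x : Profile) 1 ((x : ℕ) : ℤ)| := rfl
      _ ≤ _ := hone
      _ ≤ Γ * ρs ^ (2 * k) * (((4 : ℝ) / β) ^ k * law) +
          (4 : ℝ) ^ k * Real.exp (-((L - 2 * D) ^ 2 / (4 * N₀))) := by
          refine add_le_add ?_ hfar
          exact mul_le_mul hmono' hlawS (shellLaw_nonneg (π := π) _ _ _ _ _) (by positivity)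
      _ = B := by rw [hBdef]; ring
  -- THE SUM
  have hsum1 : ∑ k ∈ Ico 1 (D + 1), (Γ * q ^ k * law) ≤ law / 2 := by
    rw [← sum_mul, ← mul_sum]
    have hgeo : ∑ k ∈ Ico 1 (D + 1), q ^ k ≤ q / (1 - q) := by
      have := geom_sum_Ico_le_of_lt_one hq0 (by linarith only [hq4]) (m := 1) (n := D + 1)
      simpa using this
    calc Γ * (∑ k ∈ Ico 1 (D + 1), q ^ k) * law ≤ Γ * (q / (1 - q)) * law :=
          mul_le_mul_of_nonneg_right (mul_le_mul_of_nonneg_left hgeo hΓ0) hlaw0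
      _ ≤ 1 / 2 * law := mul_le_mul_of_nonneg_right hΓq hlaw0
      _ = law / 2 := by ring
  have hsum2 : ∑ k ∈ Ico 1 (D + 1), (4 / 3 : ℝ) ^ k * Real.exp (-((L - 2 * D) ^ 2 / (4 * N₀))) ≤ law / 2 := by
    refine (sum_Ico_le_mul (M := (4 / 3 : ℝ) ^ D * Real.exp (-((L - 2 * D) ^ 2 / (4 * N₀)))) ?_).trans ?_
    · intro k hk
      have hkD : k ≤ D := by have := (mem_Ico.1 hk).2; omega
      exact mul_le_mul_of_nonneg_right (pow_le_pow_right₀ (by norm_num) hkD) (by positivity)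
    · rw [← mul_assoc]; linarith only [h8, hLB]
  calc ∑ k ∈ Ico 1 (D + 1), (((2 * k).choose k : ℕ) : ℝ) / (4 : ℝ) ^ k *
          |(fwdDiff (1 : ℕ))^[k] (fun j => shellLaw π univ H (2 * s + 1) (2 * j + 1) x) 0|
      ≤ ∑ k ∈ Ico 1 (D + 1), (Γ * q ^ k * law + (4 / 3 : ℝ) ^ k * Real.exp (-((L - 2 * D) ^ 2 / (4 * N₀)))) :=
        sum_le_sum hper
    _ = ∑ k ∈ Ico 1 (D + 1), (Γ * q ^ k * law) +
          ∑ k ∈ Ico 1 (D + 1), (4 / 3 : ℝ) ^ k * Real.exp (-((L - 2 * D) ^ 2 / (4 * N₀))) := sum_add_distrib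
    _ ≤ law / 2 + law / 2 := add_le_add hsum1 hsum2
    _ = law := by ring

end Assembly

/-! ### §3 (v2 append) The quantitative per-order form -/

section AssemblyQuant

variable (hπ : ∀ v, π (π v) = v) (hπ' : ∀ v, π v ≠ v)
include hπ hπ'

/-- **RELATIVE LEVEL-SMOOTHNESS, QUANTITATIVE PER-ORDER FORM.** Under the hypotheses of `relSmooth_of_hyps` WITHOUT its last
three (the budget `16Γρ*² ≤ 3β`, the lower bound `LB` and the tail condition), for every order `1 ≤ k ≤ D`:
`(C(2k,k)/4^k)·|Δ^k[j ↦ law(t,2j+1;x)](0)| ≤ Γ·q^k·law(t,1;x) + (4/3)^k·e^{−(L−2D)²/(4N₀)}` with the EXPLICIT constants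
`η* = 8(L+D+1)/(β₁⁴βN₁)`, `Q* = 2√192·√(2(2D+1)(1+η*)/(β₁⁴βN₁))`, `ρ* = (1+η*)(η*+Q*)`, `Γ = 1 + (4(√N₀+1)/3)Q*`, `q = 4ρ*²/(3β)`
(`β₁ = β²/8`, `N₁ = N₀ − 2D`) — the per-`k` bound inside the proof of `relSmooth_of_hyps`, exported: `q ≍ D/(β⁹N₀)`-small, so the
relative level step of the law is `O(Γq)` and higher orders decay geometrically (cell pnp-psdrank, prover g26, MEMO-29 §3: the input of
brick 133's termwise bound for the centred first moment, and of brick 130's `ε_C < 1`).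
[cite: RollinRoss2010, §3 (Lemma 3.1, 3.3), §4.1 Thm 4.2] [cite: Rothvoss2017, §2 (PDF p. 6)]
[cite: Agarwal2000DifferenceEquations, Thm. 1.8.5 (1.8.6), Remark 1.8.1] -/
theorem abs_fwdDiff_iter_shellLaw_le_of_hyps
(H : Finset (Fin n)) {a b d N₀ : ℕ} (ha : (reps π (vAA π univ H)).card = a)
    (hb : (reps π (vBH π univ H ∪ vBN π univ H)).card = b) (hd : (reps π (vDD π univ H)).card = d)
    (hN : a + b + d = N₀) (hn : n = 2 * N₀)
    {β : ℝ} (hβ : 0 < β) (hβ1 : β ≤ 1 / 4) {D : ℕ} (hDN : 16 * D + 16 ≤ N₀)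
    (hbβ : β * N₀ + 2 * D + 1 ≤ b) (hdβ : β * N₀ + 2 * D + 1 ≤ d)
    {s : ℕ} (hs : β * N₀ + D ≤ s) (hs' : 8 * (s : ℝ) ≤ (4 + β) * ((N₀ : ℝ) - 2 * D))
    (hne : ∀ k, k ≤ D → (shellIn π univ (2 * s + 1) (1 + 2 * k)).Nonempty)
    {x : ℕ} {ε : ℝ} (hxε : |(x : ℝ) - (2 * (s : ℝ) + 1) * H.card / n| < ε) (hxD : 2 * D ≤ x)
    {L : ℝ} (h2D : 2 * (D : ℝ) ≤ L) (hLN : 2 * L ≤ N₀)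
    (h1 : L + D + (ε + 14 * D + 1) ≤ β ^ 2 * N₀)
    (h2 : L + D + (ε + 14 * D + 1) + 3 ≤ β * ((N₀ : ℝ) - 2 * D) / 8)
    (h3 : 2 * (L + D + 1) ≤ (β ^ 2 / 8) ^ 2 * (β * ((N₀ : ℝ) - 2 * D)))
    (h4 : 4 ≤ β * ((N₀ : ℝ) - 2 * D))
    (h5 : (D : ℝ) * (1 + 8 * (L + D + 1) / ((β ^ 2 / 8) ^ 4 * (β * ((N₀ : ℝ) - 2 * D)))) ≤
      (β ^ 2 / 8) ^ 4 * (β * ((N₀ : ℝ) - 2 * D))) :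
    ∀ k ∈ Ico 1 (D + 1), (((2 * k).choose k : ℕ) : ℝ) / (4 : ℝ) ^ k *
        |(fwdDiff (1 : ℕ))^[k] (fun j => shellLaw π univ H (2 * s + 1) (2 * j + 1) x) 0| ≤
      (1 + 4 * (Real.sqrt N₀ + 1) / 3 *
          (2 * Real.sqrt 192 * Real.sqrt (2 * (2 * (D : ℝ) + 1) * (1 + 8 * (L + D + 1) / ((β ^ 2 / 8) ^ 4 * (β * ((N₀ : ℝ) - 2 * D)))) /
            ((β ^ 2 / 8) ^ 4 * (β * ((N₀ : ℝ) - 2 * D)))))) *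
          (4 * ((1 + 8 * (L + D + 1) / ((β ^ 2 / 8) ^ 4 * (β * ((N₀ : ℝ) - 2 * D)))) *
          (8 * (L + D + 1) / ((β ^ 2 / 8) ^ 4 * (β * ((N₀ : ℝ) - 2 * D))) +
            2 * Real.sqrt 192 * Real.sqrt (2 * (2 * (D : ℝ) + 1) * (1 + 8 * (L + D + 1) / ((β ^ 2 / 8) ^ 4 * (β * ((N₀ : ℝ) - 2 * D)))) /
            ((β ^ 2 / 8) ^ 4 * (β * ((N₀ : ℝ) - 2 * D)))))) ^ 2 / (3 * β)) ^ k *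
          shellLaw π univ H (2 * s + 1) 1 x +
        (4 / 3 : ℝ) ^ k * Real.exp (-((L - 2 * D) ^ 2 / (4 * N₀))) := by
  classical
  -- abbreviations (opaque)
  obtain ⟨N₁, hN₁⟩ : ∃ e : ℝ, e = (N₀ : ℝ) - 2 * D := ⟨_, rfl⟩
  obtain ⟨ηs, hηs⟩ : ∃ e : ℝ, e = 8 * (L + D + 1) / ((β ^ 2 / 8) ^ 4 * (β * N₁)) := ⟨_, rfl⟩
  obtain ⟨Qs, hQs⟩ : ∃ e : ℝ, e = 2 * Real.sqrt 192 * Real.sqrt (2 * (2 * (D : ℝ) + 1) * (1 + ηs) /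
    ((β ^ 2 / 8) ^ 4 * (β * N₁))) := ⟨_, rfl⟩
  obtain ⟨Γ, hΓ⟩ : ∃ e : ℝ, e = 1 + 4 * (Real.sqrt N₀ + 1) / 3 * Qs := ⟨_, rfl⟩
  obtain ⟨ρs, hρs⟩ : ∃ e : ℝ, e = (1 + ηs) * (ηs + Qs) := ⟨_, rfl⟩
  rw [← hN₁] at hs' h2 h3 h4 h5 ⊢
  rw [← hηs] at h5 ⊢
  rw [← hQs, ← hΓ, ← hρs]
  obtain ⟨law, hlaw⟩ : ∃ e : ℝ, e = shellLaw π univ H (2 * s + 1) 1 x := ⟨_, rfl⟩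
  rw [← hlaw]
  obtain ⟨Λ, hΛ⟩ : ∃ e : ℝ, e = ε + 14 * D + 1 := ⟨_, rfl⟩
  rw [← hΛ] at h1 h2
  -- basic positivity / sizes
  have hst : ∀ v ∈ (univ : Finset (Fin n)), π v ∈ univ := fun v _ => mem_univ _
  have hD0 : (0 : ℝ) ≤ D := Nat.cast_nonneg _
  have hDN' : (16 : ℝ) * D + 16 ≤ N₀ := by exact_mod_cast hDN
  have hN₀pos : (0 : ℝ) < N₀ := by linarith only [hDN', hD0]
  have hN₁pos : 0 < N₁ := by rw [hN₁]; linarith only [hDN', hD0]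
  have hN₁N₀ : N₁ ≤ N₀ := by rw [hN₁]; linarith only [hD0]
  have hβ1' : β ≤ 1 := by linarith only [hβ1]
  have hε0 : 0 ≤ ε := le_of_lt (lt_of_le_of_lt (abs_nonneg _) hxε)
  have hL0 : 0 ≤ L := le_trans (by positivity) h2D
  have hΛ0 : 0 ≤ Λ := by rw [hΛ]; positivity
  have hηs0 : 0 ≤ ηs := by rw [hηs]; positivity
  have hQs0 : 0 ≤ Qs := by rw [hQs]; positivity
  have hΓ1 : 1 ≤ Γ := by
    rw [hΓ]; linarith only [show (0 : ℝ) ≤ 4 * (Real.sqrt N₀ + 1) / 3 * Qs by positivity]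
  have hΓ0 : 0 ≤ Γ := zero_le_one.trans hΓ1
  have hρs0 : 0 ≤ ρs := by rw [hρs]; positivity
  have hlaw0 : 0 ≤ law := by rw [hlaw]; exact shellLaw_nonneg (π := π) _ _ _ _ _
  have hβN₀ : 0 ≤ β * N₀ := by positivity
  have hsD : D ≤ s := by
    have : (D : ℝ) ≤ s := by linarith only [hs, hβN₀]
    exact_mod_cast this
  -- `|H| = 2a + b`
  have hHcard : (H.card : ℝ) = 2 * a + b := by
    have := card_eq_two_mul_add_of_types hπ hπ' H
    rw [ha, hb] at this
    exact_mod_cast this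
  -- the window hypothesis in centre form
  have hxwin : |(x : ℝ) - (2 * (s : ℝ) + 1) * (2 * a + b) / (2 * N₀)| ≤ ε := by
    have e : (2 * (s : ℝ) + 1) * H.card / n = (2 * (s : ℝ) + 1) * (2 * a + b) / (2 * N₀) := by
      rw [hHcard, show (n : ℝ) = 2 * N₀ by exact_mod_cast hn]
    rw [← e]; exact hxε.le
  -- the ratio `q = 4ρ*²/(3β)`
  obtain ⟨q, hqdef⟩ : ∃ e : ℝ, e = 4 * ρs ^ 2 / (3 * β) := ⟨_, rfl⟩
  rw [← hqdef]
  -- uniform constants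
  have hc0 : 0 < (β ^ 2 / 8) ^ 4 * (β * N₁) := by positivity
  -- THE PER-`k` BOUND
  intro k hk
  obtain ⟨hk1, hkD⟩ := mem_Ico.1 hk
  have hkD' : k ≤ D := by omega
  have hkDr : (k : ℝ) ≤ D := by exact_mod_cast hkD'
  have hk0r : (0 : ℝ) ≤ k := Nat.cast_nonneg _
  have hks : k ≤ s := hkD'.trans hsD
  have hskr : ((s - k : ℕ) : ℝ) = (s : ℝ) - k := by push_cast [Nat.cast_sub hks]; ring
  -- the uniform per-`S'` bound `B`
  obtain ⟨B, hBdef⟩ : ∃ e : ℝ, e = Γ * ρs ^ (2 * k) * ((4 : ℝ) / β) ^ k * law +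
    (4 : ℝ) ^ k * Real.exp (-((L - 2 * D) ^ 2 / (4 * N₀))) := ⟨_, rfl⟩
  have hB0 : 0 ≤ B := by rw [hBdef]; positivity
  -- Step 1: the singleton-window level smoothing with `ρ = 1/3`
  have ht : 2 * (s - k) + 1 + 2 * k = 2 * s + 1 := by omega
  have hne' : (shellIn π univ (2 * (s - k) + 1 + 2 * k) (1 + 2 * k)).Nonempty := by
    rw [ht]; exact hne k hkD'
  have hstep := sum_abs_nab2_iter_fwdDiff_iter_le hπ hπ' H (2 * (s - k) + 1) {(x : ℤ)}
    (ρ := 1 / 3) (B := B) (by norm_num) hB0 k 0 hst 1 hne'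
    (fun S' _ hS' hlt => by
      have h8 : 8 ≤ S'.card := by rw [card_univ, Fintype.card_fin] at hlt; omega
      have h := pairs_le_rho hπ hS' H (m := 8) (by norm_num) h8
      have e : ((8 : ℕ) : ℝ) / (4 * (((8 : ℕ) : ℝ) - 2)) = 1 / 3 := by norm_num
      rw [e] at h; exact h)
    ?_
  · -- conclude the per-`k` bound from Step 1
    simp only [sum_singleton, Function.iterate_zero, id_eq, ht] at hstep
    rw [fwdDiff_iter_one_odd_profile (fun c' x' => shellLaw π univ H (2 * s + 1) c' x' : Profile) k (x : ℤ)]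
    have hcb := centralBinom_div_four_pow_le_one' k
    calc (((2 * k).choose k : ℕ) : ℝ) / (4 : ℝ) ^ k *
          |((fwdDiff (2 : ℕ))^[k] (fun c' x' => shellLaw π univ H (2 * s + 1) c' x' : Profile)) 1 (x : ℤ)|
        ≤ 1 * ((1 / 3 : ℝ) ^ k * B) := mul_le_mul hcb hstep (abs_nonneg _) zero_le_one
      _ = Γ * q ^ k * law + (4 / 3 : ℝ) ^ k * Real.exp (-((L - 2 * D) ^ 2 / (4 * N₀))) := by
          have hβ0 : β ≠ 0 := hβ.ne'
          have e1 : (4 * ρs ^ 2 / (3 * β)) ^ k = (1 / 3 : ℝ) ^ k * (ρs ^ (2 * k) * ((4 : ℝ) / β) ^ k) := by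
            rw [show (4 : ℝ) * ρs ^ 2 / (3 * β) = 1 / 3 * (ρs ^ 2 * (4 / β)) by field_simp]
            rw [mul_pow, mul_pow, ← pow_mul]
          have e2 : (4 / 3 : ℝ) ^ k = (1 / 3 : ℝ) ^ k * 4 ^ k := by rw [← mul_pow]; norm_num
          rw [hBdef, hqdef, one_mul, e1, e2]; ring
  -- hypothesis (ii) of Step 1: the bound `B` on every `2k`-fold deleted ground set
  intro S' _ hS' hcardS'
  rw [zero_add, sum_singleton]
  rw [card_univ, Fintype.card_fin] at hcardS'
  -- types of `S'`
  obtain ⟨ha1, ha2, hb1, hb2, hd1, hd2, hN'⟩ := deleted_types hπ hπ' H ha hb hd hN hS' hcardS'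
  generalize ha' : (reps π (vAA π S' H)).card = a' at ha1 ha2 hN'
  generalize hb' : (reps π (vBH π S' H ∪ vBN π S' H)).card = b' at hb1 hb2 hN'
  generalize hd' : (reps π (vDD π S' H)).card = d' at hd1 hd2 hN'
  obtain ⟨N', hN'def⟩ : ∃ N' : ℕ, N' + 2 * k = N₀ := ⟨a' + b' + d', hN'⟩
  have hN'sum : a' + b' + d' = N' := by omega
  have hN'r : (N' : ℝ) = (N₀ : ℝ) - 2 * k := by
    have : ((N' + 2 * k : ℕ) : ℝ) = N₀ := by rw [hN'def]
    push_cast at this; linarith only [this]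
  have hN₁N' : N₁ ≤ N' := by rw [hN₁, hN'r]; linarith only [hkDr]
  have hN'N₀ : (N' : ℝ) ≤ N₀ := by rw [hN'r]; linarith only [hk0r]
  have hN'pos : (0 : ℝ) < N' := lt_of_lt_of_le hN₁pos hN₁N'
  have ha1r : (a : ℝ) ≤ a' + 2 * k := by exact_mod_cast ha1
  have ha2r : (a' : ℝ) ≤ a := by exact_mod_cast ha2
  have hb1r : (b : ℝ) ≤ b' + 2 * k := by exact_mod_cast hb1
  have hb2r : (b' : ℝ) ≤ b := by exact_mod_cast hb2
  have hd1r : (d : ℝ) ≤ d' + 2 * k := by exact_mod_cast hd1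
  have hNr : (a : ℝ) + b + d = N₀ := by exact_mod_cast hN
  have hβN' : β * N₁ ≤ β * N' := mul_le_mul_of_nonneg_left hN₁N' hβ.le
  have hβN'' : β * N' ≤ β * N₀ := mul_le_mul_of_nonneg_left hN'N₀ hβ.le
  have hc1 : (β ^ 2 / 8) ^ 4 * (β * N₁) ≤ (β ^ 2 / 8) ^ 4 * (β * N') :=
    mul_le_mul_of_nonneg_left hβN' (by positivity)
  -- Step 5: re-insertion (`k` full with base `β`, `k` empty with base `1/4`)
  have hcard2 : S'.card + 2 * (2 * k) = (univ : Finset (Fin n)).card := by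
    rw [card_univ, Fintype.card_fin]; omega
  have hnr : (n : ℝ) = 2 * N₀ := by exact_mod_cast hn
  have hS'r : (S'.card : ℝ) = 2 * N₀ - 4 * k := by
    have : ((S'.card + 4 * k : ℕ) : ℝ) = (n : ℝ) := by rw [hcardS']
    push_cast at this; linarith only [this, hnr]
  have hF : β * ((univ : Finset (Fin n)).card : ℝ) ≤ ((2 * (s - k) + 1 : ℕ) : ℝ) + 2 - (1 : ℕ) := by
    rw [card_univ, Fintype.card_fin, hnr]; push_cast; rw [hskr]
    linarith only [hs, hkDr, hβN₀]
  have hE : (1 / 4 : ℝ) * ((univ : Finset (Fin n)).card : ℝ) ≤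
      (S'.card : ℝ) + 2 - ((2 * (s - k) + 1 : ℕ) : ℝ) - 2 * (k : ℕ) - (1 : ℕ) := by
    rw [card_univ, Fintype.card_fin, hnr, hS'r]; push_cast; rw [hskr]
    have h45 : (4 + β) * N₁ ≤ 5 * N₁ := mul_le_mul_of_nonneg_right (by linarith only [hβ1']) hN₁pos.le
    rw [hN₁] at h45
    have : (4 + β) * N₁ = (4 + β) * ((N₀ : ℝ) - 2 * D) := by rw [hN₁]
    rw [this] at hs'
    linarith only [hs', h45, hDN', hkDr, hk0r]
  obtain ⟨w₀, hw₀, hreins⟩ := shellLaw_reinsertion_le hπ hπ' H 1 hβ.le (by norm_num : (0:ℝ) ≤ 1 / 4)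
    (2 * k) hst hS' (subset_univ _) hcard2 (2 * (s - k) + 1) k (by omega) hF hE
  have hreinsx := hreins (x : ℤ)
  rw [show 2 * k - k = k by omega, ht] at hreinsx
  -- the reference point `y₀ = x − w₀`
  have hw₀x : w₀ ≤ x := by omega
  obtain ⟨y₀, hy₀⟩ : ∃ y₀ : ℕ, y₀ + w₀ = x := ⟨x - w₀, by omega⟩
  have hy₀z : ((x : ℤ) - (w₀ : ℤ)) = (y₀ : ℤ) := by rw [← hy₀]; push_cast; ring
  rw [hy₀z, ← hlaw] at hreinsx
  have hw₀r : (w₀ : ℝ) ≤ 2 * k := by exact_mod_cast hw₀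
  -- the window transfer
  have hy₀win : |(y₀ : ℝ) - ((s - k : ℕ) : ℝ) * (2 * a' + b') / N'| ≤ Λ := by
    have hw := window_transfer (P := (2 * a + b : ℝ)) (P' := (2 * a' + b' : ℝ)) (s := s) (N₀ := N₀)
      (k := k) (x := x) (w₀ := w₀) (ε := ε) hN₀pos (by positivity) (by linarith only [ha2r, hb2r])
      (by linarith only [hNr, Nat.cast_nonneg (α := ℝ) d]) (by linarith only [ha1r, hb1r])
      (Nat.cast_nonneg _)
      (by have h45 : (4 + β) * N₁ ≤ 5 * N₀ := by
            calc (4 + β) * N₁ ≤ 5 * N₁ := mul_le_mul_of_nonneg_right (by linarith only [hβ1']) hN₁pos.le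
              _ ≤ 5 * N₀ := by linarith only [hN₁N₀]
          linarith only [hs', h45])
      hk0r (by linarith only [hDN', hkDr]) (Nat.cast_nonneg _) hw₀r hxwin
    have e1 : (y₀ : ℝ) = x - w₀ := by
      have : ((y₀ + w₀ : ℕ) : ℝ) = x := by rw [hy₀]
      push_cast at this; linarith only [this]
    have e2 : ((s - k : ℕ) : ℝ) * (2 * a' + b') / N' = ((s : ℝ) - k) * (2 * a' + b') / ((N₀ : ℝ) - 2 * k) := by
      rw [hN'r, hskr]
    rw [e1, e2]
    refine hw.trans ?_
    rw [hΛ]; linarith only [hkDr]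
  -- Steps 2–4 on `S'`
  have hβs : β * N' ≤ ((s - k : ℕ) : ℝ) := by rw [hskr]; linarith only [hs, hkDr, hβN'']
  have h8s : 8 * ((s - k : ℕ) : ℝ) ≤ (4 + β) * N' := by
    rw [hskr]
    have : (4 + β) * N₁ ≤ (4 + β) * N' := mul_le_mul_of_nonneg_left hN₁N' (by linarith only [hβ.le])
    linarith only [hs', this, hk0r]
  have hsN' : s - k ≤ N' := by
    have : ((s - k : ℕ) : ℝ) ≤ N' := by
      have : (4 + β) * N' ≤ 5 * N' := mul_le_mul_of_nonneg_right (by linarith only [hβ1']) hN'pos.le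
      linarith only [h8s, this]
    exact_mod_cast this
  have hη' : 8 * (L + k + 1) / ((β ^ 2 / 8) ^ 4 * (β * N')) ≤ ηs := by
    rw [hηs]
    calc 8 * (L + k + 1) / ((β ^ 2 / 8) ^ 4 * (β * N')) ≤ 8 * (L + D + 1) / ((β ^ 2 / 8) ^ 4 * (β * N')) :=
          div_le_div_of_nonneg_right (by linarith only [hkDr]) (hc0.le.trans hc1)
      _ ≤ 8 * (L + D + 1) / ((β ^ 2 / 8) ^ 4 * (β * N₁)) :=
          div_le_div_of_nonneg_left (by linarith only [hL0, hD0]) hc0 hc1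
  have hone := abs_nab2_iter_shellLaw_one_le hπ hπ' hS' H (a := a') hb' hd' hN'sum hβ hβ1'
    (by linarith only [hb1r, hbβ, hkDr, hβN''])
    (by linarith only [hd1r, hdβ, hkDr, hβN''])
    (s := s - k) hβs h8s hsN'
    (k := k) (u := w₀) (y₀ := y₀) hw₀ (L := L) (Λ := Λ)
    (by linarith only [h2D, hkDr]) (by linarith only [hLN, hN'r, hDN', hkDr, hk0r])
    (by -- `L + k + Λ ≤ β(s−k)`
        have hmul : β * (β * N₀) ≤ β * ((s - k : ℕ) : ℝ) :=
          mul_le_mul_of_nonneg_left (by rw [hskr]; linarith only [hs, hkDr]) hβ.le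
        have e : β ^ 2 * (N₀ : ℝ) = β * (β * N₀) := by ring
        linarith only [h1, hmul, hkDr, e])
    (by linarith only [h2, hβN', hkDr])
    (by have : (β ^ 2 / 8) ^ 2 * (β * N₁) ≤ (β ^ 2 / 8) ^ 2 * (β * N') :=
          mul_le_mul_of_nonneg_left hβN' (by positivity)
        linarith only [h3, this, hkDr])
    (by linarith only [h4, hβN'])
    (by calc (k : ℝ) * (1 + 8 * (L + k + 1) / ((β ^ 2 / 8) ^ 4 * (β * N'))) ≤ (D : ℝ) * (1 + ηs) :=
              mul_le_mul hkDr (by linarith only [hη']) (by positivity) hD0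
          _ ≤ (β ^ 2 / 8) ^ 4 * (β * N₁) := h5
          _ ≤ _ := hc1)
    hy₀win
  rw [hy₀] at hone
  -- bound the constants of `hone` by the uniform ones
  have hη0 : 0 ≤ 8 * (L + k + 1) / ((β ^ 2 / 8) ^ 4 * (β * N')) := by positivity
  have hQle : 2 * Real.sqrt 192 * Real.sqrt (2 * (2 * (k : ℝ) + 1) *
      (1 + 8 * (L + k + 1) / ((β ^ 2 / 8) ^ 4 * (β * N'))) / ((β ^ 2 / 8) ^ 4 * (β * N'))) ≤ Qs := by
    rw [hQs]
    refine mul_le_mul_of_nonneg_left (Real.sqrt_le_sqrt ?_) (by positivity)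
    have hnum : 2 * (2 * (k : ℝ) + 1) * (1 + 8 * (L + k + 1) / ((β ^ 2 / 8) ^ 4 * (β * N'))) ≤
        2 * (2 * (D : ℝ) + 1) * (1 + ηs) :=
      mul_le_mul (by linarith only [hkDr]) (by linarith only [hη']) (by positivity) (by positivity)
    calc _ ≤ 2 * (2 * (D : ℝ) + 1) * (1 + ηs) / ((β ^ 2 / 8) ^ 4 * (β * N')) :=
          div_le_div_of_nonneg_right hnum (hc0.le.trans hc1)
      _ ≤ 2 * (2 * (D : ℝ) + 1) * (1 + ηs) / ((β ^ 2 / 8) ^ 4 * (β * N₁)) :=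
          div_le_div_of_nonneg_left (by positivity) hc0 hc1
  have hsqrt : 4 * (Real.sqrt N' + 1) / 3 ≤ 4 * (Real.sqrt N₀ + 1) / 3 := by
    have := Real.sqrt_le_sqrt hN'N₀; linarith only [this]
  have hmono := goodConst_mono (2 * k) hη0 hη' (by positivity) hQle (by positivity) hsqrt
  rw [← hρs] at hmono
  have hmono' : ((1 + 8 * (L + k + 1) / ((β ^ 2 / 8) ^ 4 * (β * N'))) *
      (8 * (L + k + 1) / ((β ^ 2 / 8) ^ 4 * (β * N')) +
        2 * Real.sqrt 192 * Real.sqrt (2 * (2 * (k : ℝ) + 1) *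
          (1 + 8 * (L + k + 1) / ((β ^ 2 / 8) ^ 4 * (β * N'))) / ((β ^ 2 / 8) ^ 4 * (β * N'))))) ^ (2 * k) *
      (1 + 4 * (Real.sqrt N' + 1) / 3 *
        (2 * Real.sqrt 192 * Real.sqrt (2 * (2 * (k : ℝ) + 1) *
          (1 + 8 * (L + k + 1) / ((β ^ 2 / 8) ^ 4 * (β * N'))) / ((β ^ 2 / 8) ^ 4 * (β * N'))))) ≤
      Γ * ρs ^ (2 * k) := by
    rw [hΓ, mul_comm (1 + 4 * (Real.sqrt ↑N₀ + 1) / 3 * Qs)]; exact hmono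
  -- the comparability factor
  have hlawS : shellLaw π S' H (2 * (s - k) + 1) 1 y₀ ≤ ((4 : ℝ) / β) ^ k * law := by
    have hpos : 0 < β ^ k * (1 / 4 : ℝ) ^ k := by positivity
    have hprod : β ^ k * (1 / 4 : ℝ) ^ k * ((4 : ℝ) / β) ^ k = 1 := by
      rw [← mul_pow, ← mul_pow]
      have : β * (1 / 4 : ℝ) * (4 / β) = 1 := by field_simp
      rw [this, one_pow]
    have e : ((4 : ℝ) / β) ^ k * law = law / (β ^ k * (1 / 4 : ℝ) ^ k) := by
      rw [eq_div_iff hpos.ne']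
      calc (4 / β) ^ k * law * (β ^ k * (1 / 4 : ℝ) ^ k)
          = law * (β ^ k * (1 / 4 : ℝ) ^ k * ((4 : ℝ) / β) ^ k) := by ring
        _ = law := by rw [hprod, mul_one]
    rw [e, le_div_iff₀ hpos, mul_comm]
    exact hreinsx
  have e1 : 1 + 2 * (s - k) = 2 * (s - k) + 1 := by ring
  -- the far term
  have hfar : (4 : ℝ) ^ k * Real.exp (-((L - 2 * k) ^ 2 / (4 * N'))) ≤
      (4 : ℝ) ^ k * Real.exp (-((L - 2 * D) ^ 2 / (4 * N₀))) := by
    refine mul_le_mul_of_nonneg_left (Real.exp_le_exp.2 ?_) (by positivity)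
    have h0 : 0 ≤ L - 2 * D := by linarith only [h2D]
    have h1 : (L - 2 * D) ^ 2 ≤ (L - 2 * k) ^ 2 :=
      pow_le_pow_left₀ h0 (by linarith only [hkDr]) 2
    have h2 : (L - 2 * D) ^ 2 / (4 * N₀) ≤ (L - 2 * k) ^ 2 / (4 * N') := by
      calc (L - 2 * D) ^ 2 / (4 * N₀) ≤ (L - 2 * D) ^ 2 / (4 * N') :=
            div_le_div_of_nonneg_left (sq_nonneg _) (by positivity) (by linarith only [hN'N₀])
        _ ≤ (L - 2 * k) ^ 2 / (4 * N') := div_le_div_of_nonneg_right h1 (by positivity)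
    linarith only [h2]
  -- assemble `B`
  rw [e1] at hone
  calc |nab2^[k] (fun c' x => shellLaw π S' H (2 * (s - k) + 1) c' x : Profile) 1 (x : ℤ)|
      = |nab2^[k] (fun c' x => shellLaw π S' H (2 * (s - k) + 1) c' x : Profile) 1 ((x : ℕ) : ℤ)| := rfl
    _ ≤ _ := hone
    _ ≤ Γ * ρs ^ (2 * k) * (((4 : ℝ) / β) ^ k * law) +
        (4 : ℝ) ^ k * Real.exp (-((L - 2 * D) ^ 2 / (4 * N₀))) := by
        refine add_le_add ?_ hfar
        exact mul_le_mul hmono' hlawS (shellLaw_nonneg (π := π) _ _ _ _ _) (by positivity)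
    _ = B := by rw [hBdef]; ring

end AssemblyQuant

end ShellStep

end Literature.Combinatorics.Optimization

end
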